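import Literature.NumberTheory.Automorphic.SmoothInductionBigCell
import HarnessLib

/-!
# Induction from a parabolic-type subgroup is cyclic on irreducible data (the big-cell argument)

Second half of the abstract form of "parabolic induction carries irreducible representations to
finitely generated ones" (Bernstein–Zelevinsky 1976, §3.13 (c) for `GL_n`; Bernstein 1992
(Harvard notes, by Rumelhart), Ch. III; Renard 2010, VI.1.5), for a big-cell datum `𝒟` of
`P ≤ G` (`SmoothInductionBigCell`). Given a representation `τ` of `P` on `W`, a level `j₀` and a
vector `w₀ ≠ 0` fixed by `τ(P ∩ K j₀)` such that the contracting elements `t ∈ Z` act on `w₀` by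
scalars (Schur's lemma in the application) and the `M`-orbit of `w₀` spans `W` (irreducibility
of `τ|_M` in the application), every subrepresentation of `Ind_P^G τ` containing the standard
vector `φ₀ = φ_{K j₀, w₀}` is everything (`Representation.eq_top_of_stdFun_mem`); hence
`Ind_P^G τ` is a cyclic, in particular finitely generated, `k[G]`-module
(`Representation.finite_asModule_smoothInd_of_bigCellDatum`).

Proof (the big-cell argument). (1) `realisedIn_smul_apply`: translating `φ₀` by `m t` gives a
big-cell vector equal to `c · 1_C ⊗ τ(m) w₀` on `Ū`, `C = (m t)(Ū ∩ K j₀)(m t)⁻¹ ⊆ Ū ∩ K j'`,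
`τ(t) w₀ = c w₀`; summing its translates over `(Ū ∩ K j') / C` (finite: `C` is open in the
compact group `Ū ∩ K j'`) gives `c · 1_{Ū ∩ K j'} ⊗ τ(m) w₀`. (2) `realisedIn_of_mem_span`: by
linearity every `v` in the span of the `M`-orbit is realised as `1_{Ū ∩ K j'} ⊗ v`, and when
`v ∈ W^{τ(P ∩ K j')}` this vector is the standard vector `φ_{K j', v}` (big-cell vectors are
determined on `Ū`), so all standard vectors lie in `S` (`stdFun_mem_of_realisedIn`).
(3) `mem_of_mem_fixedPoints`: every `K j'`-fixed vector `f` lies in `S`, by induction on the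
number of cosets `s K j'`, `s ∈ K₀` (finitely many cover `K₀`), carrying a non-zero value:
`f(s₀) ∈ W^{τ(P ∩ K j')}` since `K₀` normalises `K j'`, and `f - s₀⁻¹ • φ_{K j', f(s₀)}` vanishes
on the coset of `s₀`; a fixed vector vanishing at all representatives is `0` by `G = P K₀`.
(4) Every vector is fixed by some `K j'` (smoothness and the neighbourhood basis).
Theorems and one auxiliary definition (`RealisedIn`); no named facts.

## References

* I. N. Bernstein, A. V. Zelevinsky, *Representations of the group `GL(n, F)` where `F` is a
  non-archimedean local field*, Russian Math. Surveys 31:3 (1976), §3.13.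
* J. Bernstein, *Representations of `p`-adic groups* (Harvard lectures, notes by K. Rumelhart,
  1992), Ch. III.
* D. Renard, *Représentations des groupes réductifs `p`-adiques*, Cours Spécialisés 17 (2010),
  VI.1.5.
-/

noncomputable section

open scoped Pointwise
open Topology

namespace Representation

/-! ### The generation argument -/

section Generation

variable {k G W : Type*} [Field k] [Group G] [TopologicalSpace G] [IsTopologicalGroup G]
  [AddCommGroup W] [Module k W] {P : Subgroup G} (𝒟 : BigCellDatum P) (τ : Representation k P W)

/-- The property "some big-cell vector of `S` restricts to `1_{Ū ∩ K j'} ⊗ v` on `Ū`" (used to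
organise the generation argument). [folklore] -/
def RealisedIn (S : Subrepresentation (smoothIndRep P τ)) (j' : ℕ) (v : W) : Prop :=
  ∃ f ∈ S, IsBigCell 𝒟 τ f ∧ ∀ u ∈ 𝒟.Ubar,
    f.toFun u = open scoped Classical in if u ∈ 𝒟.K j' then v else 0

/-- `RealisedIn S j'` is a linear condition in `v`: zero. [folklore] -/
theorem realisedIn_zero (S : Subrepresentation (smoothIndRep P τ)) (j' : ℕ) :
    RealisedIn 𝒟 τ S j' 0 :=
  ⟨0, S.toSubmodule.zero_mem, isBigCell_zero 𝒟 τ, fun u _ => by simp [SmoothInd.toFun]; rfl⟩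

/-- `RealisedIn S j'` is a linear condition in `v`: sums. [folklore] -/
theorem RealisedIn.add {S : Subrepresentation (smoothIndRep P τ)} {j' : ℕ} {v v' : W}
    (hv : RealisedIn 𝒟 τ S j' v) (hv' : RealisedIn 𝒟 τ S j' v') : RealisedIn 𝒟 τ S j' (v + v') := by
  classical
  obtain ⟨f, hfS, hfb, hf⟩ := hv
  obtain ⟨g, hgS, hgb, hg⟩ := hv'
  refine ⟨f + g, S.toSubmodule.add_mem hfS hgS, hfb.add 𝒟 τ hgb, fun u hu => ?_⟩
  rw [SmoothInd.toFun_add, Pi.add_apply, hf u hu, hg u hu]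
  split_ifs <;> simp

/-- `RealisedIn S j'` is a linear condition in `v`: scalars. [folklore] -/
theorem RealisedIn.smul {S : Subrepresentation (smoothIndRep P τ)} {j' : ℕ} {v : W} (c : k)
    (hv : RealisedIn 𝒟 τ S j' v) : RealisedIn 𝒟 τ S j' (c • v) := by
  classical
  obtain ⟨f, hfS, hfb, hf⟩ := hv
  refine ⟨c • f, S.toSubmodule.smul_mem c hfS, hfb.smul 𝒟 τ c, fun u hu => ?_⟩
  rw [SmoothInd.toFun_smul, Pi.smul_apply, hf u hu]
  split_ifs <;> simp

/-- If `v` is realised in `S` at level `j'` and `v ∈ W^{τ(P ∩ K j')}`, then the standard vector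
`φ_{K j', v}` lies in `S` (two big-cell vectors with the same values on `Ū`). [folklore] -/
theorem stdFun_mem_of_realisedIn {S : Subrepresentation (smoothIndRep P τ)} {j' : ℕ} {v : W}
    (hv : RealisedIn 𝒟 τ S j' v) (hvf : v ∈ fixedByLevel 𝒟 τ j') : stdFun 𝒟 τ j' v hvf ∈ S := by
  obtain ⟨f, hfS, hfb, hf⟩ := hv
  have : stdFun 𝒟 τ j' v hvf = f :=
    (isBigCell_stdFun 𝒟 τ j' v hvf).ext 𝒟 τ hfb fun u hu => by
      rw [toFun_stdFun_of_mem_Ubar 𝒟 τ j' v hvf hu, hf u hu]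
  rw [this]
  exact hfS

/-- **The contraction step.** Let `S` be a subrepresentation containing the standard vector
`φ₀ = φ_{K j₀, w₀}`, let `m ∈ M`, and let `t ∈ Z` act on `W` by the scalar `c` with
`(m t)(Ū ∩ K j₀)(m t)⁻¹ ⊆ K j'`. Then `c • τ(m) w₀` is realised in `S` at level `j'`: the vector
`∑_{q ∈ (Ū ∩ K j') / C} (q̃ m t) • φ₀`, `C = (m t)(Ū ∩ K j₀)(m t)⁻¹`, restricts to
`1_{Ū ∩ K j'} ⊗ c τ(m) w₀` on `Ū`. [folklore] -/
theorem realisedIn_smul_apply {S : Subrepresentation (smoothIndRep P τ)} {j₀ : ℕ} {w₀ : W}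
    {hw₀ : w₀ ∈ fixedByLevel 𝒟 τ j₀} (hS : stdFun 𝒟 τ j₀ w₀ hw₀ ∈ S) {m t : G} (hm : m ∈ 𝒟.M)
    (ht : t ∈ 𝒟.M) {c : k} (hc : τ ⟨t, 𝒟.M_le ht⟩ w₀ = c • w₀) (j' : ℕ)
    (hcontr : ∀ u ∈ 𝒟.Ubar, u ∈ 𝒟.K j₀ → m * t * u * (m * t)⁻¹ ∈ 𝒟.K j') :
    RealisedIn 𝒟 τ S j' (c • τ ⟨m, 𝒟.M_le hm⟩ w₀) := by
  classical
  set φ₀ := stdFun 𝒟 τ j₀ w₀ hw₀ with hφ₀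
  have hmt : m * t ∈ 𝒟.M := 𝒟.M.mul_mem hm ht
  -- the translate `f₁ = (m t) • φ₀` and its values on `Ū`
  set f₁ : SmoothInd P τ := smoothIndRep P τ (m * t) φ₀ with hf₁
  have hf₁b : IsBigCell 𝒟 τ f₁ := (isBigCell_stdFun 𝒟 τ j₀ w₀ hw₀).apply_M 𝒟 τ hmt
  have hf₁v : ∀ u ∈ 𝒟.Ubar, f₁.toFun u =
      if (m * t)⁻¹ * u * (m * t) ∈ 𝒟.K j₀ then c • τ ⟨m, 𝒟.M_le hm⟩ w₀ else 0 := by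
    intro u hu
    have hu' : (m * t)⁻¹ * u * (m * t) ∈ 𝒟.Ubar := by
      have := 𝒟.conj_mem_Ubar (m * t)⁻¹ (𝒟.M.inv_mem hmt) u hu
      rwa [inv_inv] at this
    rw [hf₁, toFun_apply_M 𝒟 τ φ₀ hmt u, hφ₀, toFun_stdFun_of_mem_Ubar 𝒟 τ j₀ w₀ hw₀ hu']
    split_ifs with h
    · have e : (⟨m * t, 𝒟.M_le hmt⟩ : P) = ⟨m, 𝒟.M_le hm⟩ * ⟨t, 𝒟.M_le ht⟩ := rfl
      rw [e, map_mul, Module.End.mul_apply, hc, map_smul]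
    · rw [map_zero]
  -- the subgroup `H = Ū ∩ K j'` (compact) and its open subgroup `C`
  set H : Subgroup G := 𝒟.Ubar ⊓ 𝒟.K j' with hH
  have hHc : IsCompact (H : Set G) := by
    rw [hH, Subgroup.coe_inf]
    exact (𝒟.isCompact_K j').inter_left 𝒟.isClosed_Ubar
  haveI : CompactSpace H := isCompact_iff_compactSpace.1 hHc
  set C : Subgroup H := (𝒟.K j₀).comap ((MulAut.conj (m * t)⁻¹).toMonoidHom.comp H.subtype)
    with hC
  have hmemC : ∀ h : H, h ∈ C ↔ (m * t)⁻¹ * (h : G) * (m * t) ∈ 𝒟.K j₀ := fun h => by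
    simp [hC, mul_assoc]
  have hCopen : IsOpen (C : Set H) := by
    have : (C : Set H) = ((fun g : G => (m * t)⁻¹ * g * (m * t)) ∘ ((↑) : H → G)) ⁻¹' (𝒟.K j₀ : Set G) := by
      ext h; exact hmemC h
    rw [this]
    exact (𝒟.isOpen_K j₀).preimage ((by fun_prop : Continuous fun g : G => (m * t)⁻¹ * g * (m * t)).comp
      continuous_subtype_val)
  haveI : Finite (H ⧸ C) := Subgroup.quotient_finite_of_isOpen C hCopen
  haveI : Fintype (H ⧸ C) := Fintype.ofFinite _
  -- the averaged vector
  set f₂ : SmoothInd P τ := ∑ q : H ⧸ C, smoothIndRep P τ ((q.out : H) : G) f₁ with hf₂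
  refine ⟨f₂, ?_, ?_, fun u hu => ?_⟩
  · exact S.toSubmodule.sum_mem fun q _ =>
      S.apply_mem_toSubmodule _ (S.apply_mem_toSubmodule _ hS)
  · exact IsBigCell.sum 𝒟 τ _ fun q _ => hf₁b.apply_Ubar 𝒟 τ (q.out.2).1
  · rw [hf₂, SmoothInd.toFun_sum]
    simp only [toFun_apply_Ubar]
    have hval : ∀ q : H ⧸ C, f₁.toFun (u * ((q.out : H) : G)) =
        if (m * t)⁻¹ * (u * ((q.out : H) : G)) * (m * t) ∈ 𝒟.K j₀ then c • τ ⟨m, 𝒟.M_le hm⟩ w₀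
          else 0 :=
      fun q => hf₁v _ (𝒟.Ubar.mul_mem hu (q.out.2).1)
    simp only [hval]
    by_cases huK : u ∈ 𝒟.K j'
    · -- exactly one coset contributes: the class of `u⁻¹`
      rw [if_pos huK]
      have huH : u⁻¹ ∈ H := H.inv_mem ⟨hu, huK⟩
      rw [Finset.sum_ite, Finset.sum_const_zero, add_zero, Finset.sum_const]
      have hone : (Finset.univ.filter fun q : H ⧸ C =>
          (m * t)⁻¹ * (u * ((q.out : H) : G)) * (m * t) ∈ 𝒟.K j₀).card = 1 := by
        rw [Finset.card_eq_one]
        refine ⟨QuotientGroup.mk ⟨u⁻¹, huH⟩, Finset.ext fun q => ?_⟩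
        simp only [Finset.mem_filter, Finset.mem_univ, true_and, Finset.mem_singleton]
        constructor
        · intro h
          have h' : (⟨u⁻¹, huH⟩ : H)⁻¹ * q.out ∈ C := by
            rw [hmemC]
            simpa [mul_assoc] using h
          rw [← QuotientGroup.eq, QuotientGroup.out_eq'] at h'
          exact h'.symm
        · rintro rfl
          have h' : (⟨u⁻¹, huH⟩ : H)⁻¹ *
              (QuotientGroup.mk (s := C) (⟨u⁻¹, huH⟩ : H) : H ⧸ C).out ∈ C := by
            rw [← QuotientGroup.eq, QuotientGroup.out_eq']
          rw [hmemC] at h'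
          simpa [mul_assoc] using h'
      rw [hone, one_smul]
    · rw [if_neg huK]
      refine Finset.sum_eq_zero fun q _ => ?_
      rw [if_neg]
      intro hq
      -- then `u q̃ ∈ C ⊆ H`, so `u ∈ H`, contradiction
      have h1 : u * ((q.out : H) : G) ∈ 𝒟.K j' := by
        have hUbar : (m * t)⁻¹ * (u * ((q.out : H) : G)) * (m * t) ∈ 𝒟.Ubar := by
          have := 𝒟.conj_mem_Ubar (m * t)⁻¹ (𝒟.M.inv_mem hmt) _ (𝒟.Ubar.mul_mem hu (q.out.2).1)
          rwa [inv_inv] at this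
        have := hcontr _ hUbar hq
        rwa [show m * t * ((m * t)⁻¹ * (u * ↑(Quotient.out q)) * (m * t)) * (m * t)⁻¹ =
          u * ((q.out : H) : G) by group] at this
      exact huK (by simpa using (𝒟.K j').mul_mem h1 ((𝒟.K j').inv_mem (q.out.2).2))

/-- **All values are realised.** If `S ∋ φ₀ = φ_{K j₀, w₀}` with `w₀ ≠ 0`, the contracting
elements act on `w₀` by scalars, then every vector in the `k`-span of the `M`-orbit of `w₀` is
realised in `S` at every level `j'`. [folklore] -/
theorem realisedIn_of_mem_span {S : Subrepresentation (smoothIndRep P τ)} {j₀ : ℕ} {w₀ : W}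
    {hw₀ : w₀ ∈ fixedByLevel 𝒟 τ j₀} (hS : stdFun 𝒟 τ j₀ w₀ hw₀ ∈ S) (hw₀0 : w₀ ≠ 0)
    (hZ : ∀ (t : G) (ht : t ∈ 𝒟.Z), ∃ c : k, τ ⟨t, 𝒟.M_le (𝒟.Z_subset ht)⟩ w₀ = c • w₀) (j' : ℕ)
    {v : W} (hv : v ∈ Submodule.span k (Set.range fun m : 𝒟.M => τ ⟨m, 𝒟.M_le m.2⟩ w₀)) :
    RealisedIn 𝒟 τ S j' v := by
  induction hv using Submodule.span_induction with
  | mem x hx =>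
    obtain ⟨m, rfl⟩ := hx
    obtain ⟨t, htZ, hcontr⟩ := 𝒟.exists_contract j₀ j' m m.2
    obtain ⟨c, hc⟩ := hZ t htZ
    have hc0 : c ≠ 0 := by
      rintro rfl
      rw [zero_smul] at hc
      exact hw₀0 (by simpa using congrArg (τ ⟨t, 𝒟.M_le (𝒟.Z_subset htZ)⟩⁻¹) hc)
    have h := (realisedIn_smul_apply 𝒟 τ hS m.2 (𝒟.Z_subset htZ) hc j' hcontr).smul 𝒟 τ c⁻¹
    rwa [smul_smul, inv_mul_cancel₀ hc0, one_smul] at h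
  | zero => exact realisedIn_zero 𝒟 τ S j'
  | add x y _ _ hx hy => exact hx.add 𝒟 τ hy
  | smul c x _ hx => exact hx.smul 𝒟 τ c

/-- A compact subgroup is covered by finitely many cosets `s K` of an open subgroup with
representatives `s` in the subgroup. [folklore] -/
theorem exists_finset_cover (K₀ K : Subgroup G) (hK₀ : IsCompact (K₀ : Set G))
    (hK : IsOpen (K : Set G)) :
    ∃ T : Finset G, (∀ s ∈ T, s ∈ K₀) ∧ ∀ x ∈ K₀, ∃ s ∈ T, s⁻¹ * x ∈ K := by
  classical
  obtain ⟨t, ht⟩ := hK₀.elim_finite_subcover (fun s : K₀ => ((s : G) * ·) '' (K : Set G))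
    (fun s => isOpenMap_mul_left (s : G) _ hK)
    (fun x hx => Set.mem_iUnion.2 ⟨⟨x, hx⟩, 1, K.one_mem, mul_one x⟩)
  refine ⟨t.image (↑), fun s hs => ?_, fun x hx => ?_⟩
  · obtain ⟨s', -, rfl⟩ := Finset.mem_image.1 hs
    exact s'.2
  · obtain ⟨s, hs, hx'⟩ := Set.mem_iUnion₂.1 (ht hx)
    obtain ⟨κ, hκ, rfl⟩ := hx'
    exact ⟨s, Finset.mem_image_of_mem _ hs, by rwa [inv_mul_cancel_left]⟩

/-- **`K j'`-fixed vectors are generated.** If `S` contains every standard vector of level `j'`,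
then `S` contains every `K j'`-fixed vector of `Ind_P^G τ`: by induction on the number of cosets
`s K j'` (`s ∈ K₀`) on which `f` is non-zero, subtracting `s₀⁻¹ • φ_{K j', f(s₀)}`
(`f(s₀) ∈ W^{τ(P ∩ K j')}` because `K₀` normalises `K j'`), and `f = 0` once it vanishes on all
representatives (Iwasawa decomposition `G = P K₀`). [folklore] -/
theorem mem_of_mem_fixedPoints {S : Subrepresentation (smoothIndRep P τ)} (j' : ℕ)
    (hstd : ∀ (v : W) (hv : v ∈ fixedByLevel 𝒟 τ j'), stdFun 𝒟 τ j' v hv ∈ S)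
    {f : SmoothInd P τ} (hf : f ∈ (smoothIndRep P τ).fixedPoints (𝒟.K j')) : f ∈ S := by
  classical
  set K := 𝒟.K j' with hKdef
  obtain ⟨T, hTK₀, hT⟩ := exists_finset_cover 𝒟.K₀ K 𝒟.isCompact_K₀ (𝒟.isOpen_K j')
  -- values at `K₀`-points of a `K`-fixed vector are admissible values
  have hval : ∀ {g : SmoothInd P τ}, g ∈ (smoothIndRep P τ).fixedPoints K →
      ∀ s ∈ 𝒟.K₀, g.toFun s ∈ fixedByLevel 𝒟 τ j' := by
    intro g hg s hs p hp
    rw [mem_fixedPoints] at hg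
    have h1 : g.toFun ((p : G) * s) = τ p (g.toFun s) := g.toFun_subgroup_mul p s
    have h2 : (p : G) * s = s * (s⁻¹ * p * s⁻¹⁻¹) := by group
    have hκ : s⁻¹ * (p : G) * s⁻¹⁻¹ ∈ K := 𝒟.conj_mem_K j' s⁻¹ (𝒟.K₀.inv_mem hs) p hp
    rw [← h1, h2, ← toFun_smoothIndRep_apply, hg _ hκ]
  -- `K`-fixedness of translates `s⁻¹ • φ` of `K`-fixed vectors, `s ∈ K₀`
  have hfix : ∀ {g : SmoothInd P τ}, g ∈ (smoothIndRep P τ).fixedPoints K → ∀ s ∈ 𝒟.K₀,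
      smoothIndRep P τ s⁻¹ g ∈ (smoothIndRep P τ).fixedPoints K := by
    intro g hg s hs
    rw [mem_fixedPoints] at hg ⊢
    intro κ hκ
    rw [← Module.End.mul_apply, ← map_mul,
      show κ * s⁻¹ = s⁻¹ * (s * κ * s⁻¹) by group, map_mul, Module.End.mul_apply,
      hg _ (𝒟.conj_mem_K j' s hs κ hκ)]
  -- induction on the number of representatives carrying a non-zero value
  suffices key : ∀ (N : ℕ) (g : SmoothInd P τ), g ∈ (smoothIndRep P τ).fixedPoints K →
      (T.filter fun s => g.toFun s ≠ 0).card ≤ N → g ∈ S from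
    key _ f hf le_rfl
  intro N
  induction N with
  | zero =>
    intro g hg hN
    have hzero : ∀ s ∈ T, g.toFun s = 0 := fun s hs => by
      by_contra h
      have : s ∈ T.filter fun s => g.toFun s ≠ 0 := Finset.mem_filter.2 ⟨hs, h⟩
      rw [Nat.le_zero, Finset.card_eq_zero] at hN
      rw [hN] at this
      exact absurd this (Finset.notMem_empty s)
    have : g = 0 := by
      refine SmoothInd.ext (funext fun x => ?_)
      obtain ⟨p, hp, s', hs', rfl⟩ := 𝒟.exists_mul_eq x
      obtain ⟨s, hs, hκ⟩ := hT s' hs'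
      rw [mem_fixedPoints] at hg
      rw [show p * s' = ((⟨p, hp⟩ : P) : G) * (s * (s⁻¹ * s')) by simp, g.toFun_subgroup_mul,
        ← toFun_smoothIndRep_apply, hg _ hκ, hzero s hs, map_zero]
      rfl
    rw [this]
    exact S.toSubmodule.zero_mem
  | succ N ih =>
    intro g hg hN
    by_cases hempty : (T.filter fun s => g.toFun s ≠ 0) = ∅
    · exact ih g hg (by rw [hempty, Finset.card_empty]; exact Nat.zero_le _)
    obtain ⟨s₀, hs₀⟩ := Finset.nonempty_iff_ne_empty.2 hempty
    obtain ⟨hs₀T, hgs₀⟩ := Finset.mem_filter.1 hs₀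
    have hs₀K₀ : s₀ ∈ 𝒟.K₀ := hTK₀ s₀ hs₀T
    set w : W := g.toFun s₀ with hw
    have hwf : w ∈ fixedByLevel 𝒟 τ j' := hval hg s₀ hs₀K₀
    set φ : SmoothInd P τ := stdFun 𝒟 τ j' w hwf with hφ
    set g' : SmoothInd P τ := g - smoothIndRep P τ s₀⁻¹ φ with hg'
    have hφS : smoothIndRep P τ s₀⁻¹ φ ∈ S := S.apply_mem_toSubmodule _ (hstd w hwf)
    have hg'fix : g' ∈ (smoothIndRep P τ).fixedPoints K :=
      Submodule.sub_mem _ hg (hfix (stdFun_mem_fixedPoints 𝒟 τ j' w hwf) s₀ hs₀K₀)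
    -- the values of `g'` at the representatives
    have hg'val : ∀ s ∈ T, g'.toFun s ≠ 0 → g.toFun s ≠ 0 ∧ s ≠ s₀ := by
      intro s _ hs
      have e : g'.toFun s = g.toFun s - φ.toFun (s * s₀⁻¹) := by
        rw [hg', sub_eq_add_neg, SmoothInd.toFun_add, Pi.add_apply,
          show -(smoothIndRep P τ s₀⁻¹ φ) = (-1 : k) • smoothIndRep P τ s₀⁻¹ φ by simp,
          SmoothInd.toFun_smul, Pi.smul_apply, toFun_smoothIndRep_apply, neg_one_smul,
          ← sub_eq_add_neg]
      constructor
      · -- if `φ(s s₀⁻¹) ≠ 0` then `s ∈ P (Ū ∩ K) s₀` and `g' s = 0`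
        intro hgs
        by_cases hφs : φ.toFun (s * s₀⁻¹) = 0
        · rw [e, hgs, hφs, sub_zero] at hs
          exact hs rfl
        · obtain ⟨p, hp, u, hu, huK, hsu⟩ := exists_of_stdFunAux_ne_zero 𝒟 τ hφs
          apply hs
          rw [e, sub_eq_zero, hsu, hφ, toFun_stdFun, stdFunAux_mul 𝒟 τ w hp hu huK]
          have hs' : s = ((⟨p, hp⟩ : P) : G) * (s₀ * (s₀⁻¹ * u * s₀)) := by
            rw [show ((⟨p, hp⟩ : P) : G) * (s₀ * (s₀⁻¹ * u * s₀)) = p * u * s₀ by group, ← hsu,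
              inv_mul_cancel_right]
          have hκ : s₀⁻¹ * u * s₀ ∈ K := by
            have := 𝒟.conj_mem_K j' s₀⁻¹ (𝒟.K₀.inv_mem hs₀K₀) u huK
            rwa [inv_inv] at this
          rw [mem_fixedPoints] at hg
          rw [hs', g.toFun_subgroup_mul, ← toFun_smoothIndRep_apply, hg _ hκ]
      · rintro rfl
        apply hs
        rw [e, mul_inv_cancel, hφ, toFun_stdFun_one, hw, sub_self]
    have hcard : (T.filter fun s => g'.toFun s ≠ 0).card ≤ N := by
      have hsub : (T.filter fun s => g'.toFun s ≠ 0) ⊆ (T.filter fun s => g.toFun s ≠ 0).erase s₀ := by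
        intro s hs
        obtain ⟨hsT, hs'⟩ := Finset.mem_filter.1 hs
        obtain ⟨h1, h2⟩ := hg'val s hsT hs'
        exact Finset.mem_erase.2 ⟨h2, Finset.mem_filter.2 ⟨hsT, h1⟩⟩
      have := (Finset.card_le_card hsub).trans (Finset.card_erase_le.trans le_rfl)
      have h2 := Finset.card_erase_of_mem hs₀
      have h3 := Finset.card_le_card hsub
      omega
    have hg'S : g' ∈ S := ih g' hg'fix hcard
    have : g = g' + smoothIndRep P τ s₀⁻¹ φ := by rw [hg', sub_add_cancel]
    rw [this]
    exact S.toSubmodule.add_mem hg'S hφS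

/-- **`Ind_P^G τ` is generated by one standard vector.** Let `𝒟` be a big-cell datum for `P`,
`w₀ ≠ 0` a vector fixed by `τ(P ∩ K j₀)` on which the contracting elements `t ∈ Z` act by
scalars and whose `M`-orbit spans `W`. Then every subrepresentation of `Ind_P^G τ` containing
`φ₀ = φ_{K j₀, w₀}` is everything. (Bernstein–Zelevinsky 1976, §3.13 (c): for `GL_n`, induction
preserves finite generation; Bernstein 1992, Ch. III; Renard 2010, VI.1.5.)
[cite: BernsteinZelevinsky1976, §3.13] -/
theorem eq_top_of_stdFun_mem {j₀ : ℕ} {w₀ : W} (hw₀ : w₀ ∈ fixedByLevel 𝒟 τ j₀) (hw₀0 : w₀ ≠ 0)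
    (hZ : ∀ (t : G) (ht : t ∈ 𝒟.Z), ∃ c : k, τ ⟨t, 𝒟.M_le (𝒟.Z_subset ht)⟩ w₀ = c • w₀)
    (hgen : ∀ v : W, v ∈ Submodule.span k (Set.range fun m : 𝒟.M => τ ⟨m, 𝒟.M_le m.2⟩ w₀))
    (S : Subrepresentation (smoothIndRep P τ)) (hS : stdFun 𝒟 τ j₀ w₀ hw₀ ∈ S) : S = ⊤ := by
  refine eq_top_iff.2 fun f _ => ?_
  -- `f` is fixed by some `K j'`
  have hopen : IsOpen ((smoothIndRep P τ).stabilizerSubgroup f : Set G) := isSmooth_smoothInd P τ f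
  obtain ⟨j', hj'⟩ := 𝒟.exists_K_subset _ (hopen.mem_nhds (Subgroup.one_mem _))
  have hf : f ∈ (smoothIndRep P τ).fixedPoints (𝒟.K j') :=
    ((smoothIndRep P τ).mem_fixedPoints_iff_le_stabilizerSubgroup _ f).2 fun g hg => hj' hg
  exact mem_of_mem_fixedPoints 𝒟 τ j' (fun v hv => stdFun_mem_of_realisedIn 𝒟 τ
    (realisedIn_of_mem_span 𝒟 τ hS hw₀0 hZ j' (hgen v)) hv) hf

/-- **`Ind_P^G τ` is a cyclic, in particular finitely generated, `k[G]`-module** under the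
hypotheses of `eq_top_of_stdFun_mem`: it is generated by the single standard vector
`φ_{K j₀, w₀}`. (Bernstein–Zelevinsky 1976, §3.13 (c); Bernstein 1992, Ch. III; Renard 2010,
VI.1.5: parabolic induction preserves finite generation.) [cite: BernsteinZelevinsky1976, §3.13] -/
theorem finite_asModule_smoothInd_of_bigCellDatum {j₀ : ℕ} {w₀ : W}
    (hw₀ : w₀ ∈ fixedByLevel 𝒟 τ j₀) (hw₀0 : w₀ ≠ 0)
    (hZ : ∀ (t : G) (ht : t ∈ 𝒟.Z), ∃ c : k, τ ⟨t, 𝒟.M_le (𝒟.Z_subset ht)⟩ w₀ = c • w₀)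
    (hgen : ∀ v : W, v ∈ Submodule.span k (Set.range fun m : 𝒟.M => τ ⟨m, 𝒟.M_le m.2⟩ w₀)) :
    Module.Finite (MonoidAlgebra k G) (smoothIndRep P τ).asModule := by
  set φ₀ := stdFun 𝒟 τ j₀ w₀ hw₀ with hφ₀
  have htop : (smoothIndRep P τ).orbitSpan φ₀ = ⊤ :=
    eq_top_of_stdFun_mem 𝒟 τ hw₀ hw₀0 hZ hgen _ ⟨Finsupp.single 1 1, by simp [hφ₀]⟩
  refine finite_asModule_of_span_orbit_eq_top (smoothIndRep P τ) (Set.finite_singleton φ₀) ?_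
  refine eq_top_iff.2 fun f _ => ?_
  have hf : f ∈ (smoothIndRep P τ).orbitSpan φ₀ := by rw [htop]; trivial
  obtain ⟨c, rfl⟩ := hf
  induction c using Finsupp.induction_linear with
  | zero => simp
  | add c₁ c₂ h₁ h₂ =>
    rw [map_add]
    exact Submodule.add_mem _ (h₁ (Submodule.mem_top)) (h₂ Submodule.mem_top)
  | single g a =>
    rw [orbitCombination_single]
    exact Submodule.smul_mem _ a (Submodule.subset_span ⟨g, φ₀, Set.mem_singleton φ₀, rfl⟩)

end Generation

end Representation
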